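import Literature.MathematicalPhysics.QuantumFieldTheory.Balaban1983to89.B9Thm311PerMemberCubeZd
import Literature.MathematicalPhysics.QuantumFieldTheory.Balaban1983to89.B9Thm311PosDefNearFlatZd
import Literature.MathematicalPhysics.QuantumFieldTheory.Balaban1983to89.B9Eq17RegimeBallZd
import Literature.MathematicalPhysics.QuantumFieldTheory.Balaban1983to89.B9Eq334GaugeCovarianceZdHerm

/-!
# `Balaban1983to89.B9Thm311PerMemberCubeZdUnconditional` — [Balaban1985BackgroundPropagators] Thm 3.11 p. 416 AT ONE CUBE MEMBER FOR EVERY SMALL FIELD NEAR IT,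
# UNCONDITIONAL: the companion of `B9Thm311PerMemberCubeZd` with the displayed (B) «uniform ball» and (G) «orbit» hypotheses DISCHARGED BY NAME —
# (B) dag-n06-w4 g3's `B9Thm311PosDefNearFlatZd.{regularAtH, bondPair_pos}_eventually_one_cube_reg17UnivP` read on dag-n06-w2 g3's uniform ball
# `B9Eq17RegimeBallZd.exists_uniform_ball_of_eventually_reg17UnivP`; (G) dag-n06-w3 g3's `B9Eq334GaugeCovarianceZdHerm.{regularAtH_opsAllZd_gaugeAct_iff,
# posDefH_opsAllZd_gaugeAct}` at the P₀ box clause (`hbox0_cubeLamBP_of_eq`)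

statement-level skeleton of published theorems with citation tags; proofs where landed; nothing here is a claim about the
Yang–Mills mass gap

`[Balaban1985BackgroundPropagators]` ("B9", CMP **99** (1985) 389–434) p. 416, Thm 3.11 (quoted in the companion's header) with its proof's gauge step «Doing
the gauge transformation we get the configuration U = e^{iηA} with A small»; (3.27) p. 395; (3.34)–(3.35) p. 396.  `[Balaban1985RegularSpaces]` (1.7) p. 77,
(1.58) p. 86, (1.131) p. 99.

CITATION HEADER (lean-in-tree rule).  Cell `pub-ymgap` (YM-PLAN Track A, HUMAN RULING D-0062), DAG node N06 = [B9], seat `pub-ymgap-dag-n06-b` generation 19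
(INTENT-4 part B).  Every input is a landed theorem used BY NAME; nothing restated.

WHAT IS PROVED (kernel, 0 sorry, 0 def).
* ★★★ `regularAtH_of_pdevOn_lt_cube` — at a cube member (`Ω = cubeFam false …`, `Λs = cubeLamS …`, class `cubeLamBP`, `m ≤ k`, `2 ≤ d`, `2 ≤ L ≤ ρ`), faithful Hermitian
  tracial `τ`, finite-dimensional fibre: `∃ α > 0, ∀ unitary U₀, pdevOn (sqLo₀ − 3) (sqHi₀ + 3) U₀ < α → RegularAtH i.η (opsAllZd τ L (cubeLamBP …) ops₀ M i m) (i.Ω 0) U₀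
  ∧ Reg17 L m i.Ω (α_Q∕L²) U₀` — `G_𝔤(U₀) = (□₀Δ_a(U₀)□₀)⁻¹` EXISTS for the genuine four-letter `Δ_a` at every small field near the member, and the letter is print's.
* ★★★ `posDefH_of_pdevOn_lt_cube` — «Δ_a is positive definite» on `E_𝔤(□₀)` at every such `U₀`.
* ★★★ `gopZdH_deltaAOf_of_pdevOn_lt_cube` ((3.27) as (1.58) uses it) · ★★ `existsUnique_dirichlet_of_pdevOn_lt_cube`.

HONEST SCOPE ∕ A6.  As the companion: PER MEMBER (`α` depends on the cube member), hypothesis on the BOX `□₀ ± 3`; no bound on `G_𝔤(U₀)`, nothing of Thm 3.3,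
no uniform `α₀′`∕`M₀`∕(3.115); the junction's binder `InvAtH` is NOT inhabited here (its guard is the frame's `Reg335`).  Non-vacuity: `U₀ = 1` at every
member.  Count-neutral helper of K1⁷ (`--supports stmt-QuantumFields-20542`); N05∕N06 NOT discharged; one finite `𝕋⁴` programme at fixed `ε`, Bałaban as
printed; R4 closes only the conditional finite-`𝕋⁴` rung `BalabanLadder.UV` — nothing continuum ∕ `ℝ⁴` ∕ OS ∕ mass gap ∕ Clay.  Unit `pub-ymgap-dag-n06-b`
(g19), 2026-08-28.
-/

noncomputable section

open scoped BigOperators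

namespace Literature.MathematicalPhysics.QuantumFieldTheory.Balaban1983to89.B9Thm311PerMemberCubeZdUnconditional

open B7Prop1Explicit (e gaugeAct)
open B7Prop1Local (InBox AgreeOn PlaqIn pdevOn)
open B7Prop2Explicit (unitaryUnits unitaryUnits_le_U1)
open B8Ineq132 (PlaqTouches BondTouches)
open B8Eq131Cubes (cube sqLo sqHi cube_anti)
open B8Eq131CubesAdmissible (cubeFam cubeFam_false_of_le)
open B8CubeMemberZd (cubeLamS)
open B8Ineq159FlatCubeMemberPrinted (cubeLamBP)
open B8LeafModelZd (ZdIdx)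
open B9SupplySockB9P3ZdLetters (OpsZd deltaAOf)
open B9Eq327GreenZd (domSub bondPair)
open B9Eq327GreenZdHerm (domSubH RegularAtH gopZdH gopZdH_apply_eq_of_regularAtH domSubH_le)
open B9Eq333ProjectionCovarianceZd (gaugeAct_inv_gaugeAct inv_mem_unitaryUnits)
open B9Eq334GaugeCovarianceZd (gaugeAct_mem_unitaryUnits')
open B9SupplySockB9P3ZdAllLettersZd (opsAllZd)
open B9Eq316AveragingTransposeZd (Reg17 alphaQ alphaQ_pos)
open B9Eq316AveragingTransposeZdLevelZero (hbox0_cubeLamBP_of_eq)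
open B9Thm311PerMemberCubeZd (regularAtH_and_reg17_of_pdevOn_lt_cube_of posDefH_of_pdevOn_lt_cube_of)

export B7Prop1Explicit (Site)

variable {d : ℕ} {𝔸 : Type*} [CStarAlgebra 𝔸] [Nontrivial 𝔸]

/-! ## The knit, unconditional -/

section Unconditional

variable (τ : 𝔸 →ₗ[ℂ] ℂ) [FiniteDimensional ℝ 𝔸] {L : ℕ}
  (hτp : ∀ a : 𝔸, a ≠ 0 → 0 < (τ (star a * a)).re) (hτt : ∀ a b : 𝔸, τ (a * b) = τ (b * a))
  (hτs : ∀ a : 𝔸, τ (star a) = starRingEnd ℂ (τ a))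

include hτp hτt hτs in
/-- ★★★ **[B9] THEOREM 3.11 AT ONE CUBE MEMBER, FOR EVERY SMALL FIELD NEAR IT — UNCONDITIONAL.**  At a cube member of [Balaban1985RegularSpaces] (1.131)
(`Ω = cubeFam false L a Mc ρ k`, `Λs = cubeLamS …`, every truncation `m ≤ k`, `2 ≤ d`, `2 ≤ L ≤ ρ`), for print's constraint class `cubeLamBP` and a faithful
Hermitian tracial `τ` on a finite-dimensional fibre, THERE IS `α > 0` (depending on the member) such that for EVERY unitary background `U₀` whose plaquette
variables satisfy `‖U₀(∂p) − 1‖ < α` for the plaquettes `p` of the box `□₀ ± 3`: the genuine four-letter `Δ_a(U₀) = D*D + Δ′(U₀) + D R(U₀) 𝟙 D* + Q*aQ(U₀)`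
restricted to `□₀` is an INVERTIBLE operator of `E_𝔤(□₀)` (`RegularAtH`: `G_𝔤(U₀) = (□₀Δ_a(U₀)□₀)⁻¹` EXISTS, (3.27)), and `U₀` lies in print's class (1.7) of the
member (so `Q*aQ` is print's operator there).  PROOF = print's p. 416: flat positivity (this seat g18) ⟹ positivity and regularity for all (1.7)-on-`ℤᵈ`
backgrounds near `1` (dag-n06-w4 g3, continuity; dag-n06-w2 g3, linearity ∕ Hermiticity and the uniform ball) ⟹ along gauge orbits (dag-n06-w3 g3, (3.34))
⟹ every small field, by the axial gauge and two cut-offs (this file's §2 with this seat's locality and gauge-step files).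
[cite: Balaban1985BackgroundPropagators, Thm 3.11 p.416, (3.27) p.395, (3.34)–(3.35) p.396; Balaban1985RegularSpaces, (1.7) p.77, (1.131) p.99; Balaban1985Averaging, p.24 l.-2–p.25 l.2] -/
theorem regularAtH_of_pdevOn_lt_cube (hd2 : 2 ≤ d) (hL : 2 ≤ L) (ops₀ : ℝ → ZdIdx d L → ℕ → OpsZd d 𝔸) (M : ℝ) (i : ZdIdx d L)
    {a : Site d} {Mc ρ : ℕ} (hρ : L ≤ ρ) (hΩ : i.Ω = cubeFam false L a Mc ρ i.k) (hΛs : i.Λs = cubeLamS L a Mc ρ i.k) {m : ℕ} (hm : m ≤ i.k) :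
    ∃ α : ℝ, 0 < α ∧ ∀ U₀ : Site d → Fin d → 𝔸ˣ, (∀ x κ, U₀ x κ ∈ unitaryUnits 𝔸) →
      pdevOn (fun i' => sqLo L a ρ i.k 0 i' - 3) (fun i' => sqHi L a Mc ρ i.k 0 i' + 3) U₀ < α →
        RegularAtH i.η (opsAllZd τ L (cubeLamBP L a Mc ρ i.k) ops₀ M i m) (i.Ω 0) U₀ ∧
          Reg17 L m i.Ω (alphaQ d L / (L : ℝ) ^ 2) U₀ := by
  haveI : NeZero L := ⟨by omega⟩
  have hL1 : 1 ≤ L := le_trans (by norm_num) hL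
  have hfin : (i.Ω 0).Finite := B9Thm311PosDefOpenZd.cubeMember_Ω0_finite i hΩ
  -- (B): regularity ∀ᶠ within the (1.7)-on-ℤᵈ regime at the flat background, read on a uniform ball
  have hev := B9Thm311PosDefNearFlatZd.regularAtH_eventually_one_cube_reg17UnivP (τ := τ) (hτp := hτp) (hτt := hτt) (hτs := hτs)
    hd2 hL ops₀ M i hΩ hΛs hρ hm
  have hball := B9Eq17RegimeBallZd.exists_uniform_ball_of_eventually_reg17UnivP (𝔸 := 𝔸) hL1 m hev
  -- (G): regularity passes along gauge orbits (P₀ box clause at print's class)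
  have hcov : ∀ (u : Site d → 𝔸ˣ) (U : Site d → Fin d → 𝔸ˣ), (∀ x, u x ∈ unitaryUnits 𝔸) → (∀ x κ, U x κ ∈ unitaryUnits 𝔸) →
      RegularAtH i.η (opsAllZd τ L (cubeLamBP L a Mc ρ i.k) ops₀ M i m) (i.Ω 0) (gaugeAct u U) →
        RegularAtH i.η (opsAllZd τ L (cubeLamBP L a Mc ρ i.k) ops₀ M i m) (i.Ω 0) U :=
    fun u U hu hU h => (B9Eq334GaugeCovarianceZdHerm.regularAtH_opsAllZd_gaugeAct_iff τ L (cubeLamBP L a Mc ρ i.k) ops₀ M i m hL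
      (hbox0_cubeLamBP_of_eq hL1 i a Mc hρ hΩ hm) hτt hτs hτp hU hu hfin).mp h
  exact regularAtH_and_reg17_of_pdevOn_lt_cube_of τ hL ops₀ M i hρ hΩ hΛs hfin hm hball hcov

include hτp hτt hτs in
/-- ★★★ **[B9] THEOREM 3.11's «Δ_a IS POSITIVE DEFINITE» AT ONE CUBE MEMBER, FOR EVERY SMALL FIELD NEAR IT — UNCONDITIONAL**: `α > 0` (member-dependent) with
`0 < ⟨A, Δ_a(U₀)A⟩_τ` for every Hermitian `0 ≠ A ∈ E(□₀)` and every unitary `U₀` whose plaquettes are `α`-close to `1` on `□₀ ± 3` — (B) dag-n06-w4's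
`bondPair_pos_eventually_one_cube_reg17UnivP` read on dag-n06-w2's uniform ball, (G) dag-n06-w3's `posDefH_opsAllZd_gaugeAct` at `u⁻¹`, (L) this seat.
[cite: Balaban1985BackgroundPropagators, Thm 3.11 p.416 («Δ_a, G are positive definite»), (3.34) p.396; Balaban1985RegularSpaces, (1.7) p.77, (1.131) p.99] -/
theorem posDefH_of_pdevOn_lt_cube (hd2 : 2 ≤ d) (hL : 2 ≤ L) (ops₀ : ℝ → ZdIdx d L → ℕ → OpsZd d 𝔸) (M : ℝ) (i : ZdIdx d L)
    {a : Site d} {Mc ρ : ℕ} (hρ : L ≤ ρ) (hΩ : i.Ω = cubeFam false L a Mc ρ i.k) (hΛs : i.Λs = cubeLamS L a Mc ρ i.k) {m : ℕ} (hm : m ≤ i.k) :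
    ∃ α : ℝ, 0 < α ∧ ∀ U₀ : Site d → Fin d → 𝔸ˣ, (∀ x κ, U₀ x κ ∈ unitaryUnits 𝔸) →
      pdevOn (fun i' => sqLo L a ρ i.k 0 i' - 3) (fun i' => sqHi L a Mc ρ i.k 0 i' + 3) U₀ < α →
        ∀ A ∈ domSubH (𝔸 := 𝔸) (i.Ω 0), A ≠ 0 → 0 < bondPair τ A (deltaAOf i.η (opsAllZd τ L (cubeLamBP L a Mc ρ i.k) ops₀ M i m) U₀ A) := by
  haveI : NeZero L := ⟨by omega⟩
  have hL1 : 1 ≤ L := le_trans (by norm_num) hL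
  have hfin : (i.Ω 0).Finite := B9Thm311PosDefOpenZd.cubeMember_Ω0_finite i hΩ
  have hev := B9Thm311PosDefNearFlatZd.bondPair_pos_eventually_one_cube_reg17UnivP (τ := τ) (hτp := hτp) (hτt := hτt) (hτs := hτs)
    hd2 hL ops₀ M i hΩ hΛs hρ hm
  have hball := B9Eq17RegimeBallZd.exists_uniform_ball_of_eventually_reg17UnivP (𝔸 := 𝔸) hL1 m hev
  have hbox := hbox0_cubeLamBP_of_eq hL1 i a Mc hρ hΩ hm
  refine posDefH_of_pdevOn_lt_cube_of τ hL ops₀ M i hρ hΩ hΛs hfin hm hball fun u U hu hU h => ?_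
  have h' := B9Eq334GaugeCovarianceZdHerm.posDefH_opsAllZd_gaugeAct τ L (cubeLamBP L a Mc ρ i.k) ops₀ M i m (u := u⁻¹) (U₀ := gaugeAct u U) hL hbox
    hτt hτs hτp (gaugeAct_mem_unitaryUnits' hU hu) (inv_mem_unitaryUnits hu) hfin h
  rwa [gaugeAct_inv_gaugeAct] at h'

include hτp hτt hτs in
/-- ★★★ **(3.27) AS [Balaban1985RegularSpaces] (1.58) USES IT, AT EVERY SMALL FIELD NEAR THE MEMBER**: `G_𝔤(U₀)J = A` for every Hermitian `A ∈ E(□₀)` and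
every `J` agreeing with `Δ_a(U₀)A` on the bonds of `□₀` — unconditional, `α` as in `regularAtH_of_pdevOn_lt_cube`.
[cite: Balaban1985BackgroundPropagators, (3.27) p.395, Thm 3.11 p.416; Balaban1985RegularSpaces, (1.58) p.86] -/
theorem gopZdH_deltaAOf_of_pdevOn_lt_cube (hd2 : 2 ≤ d) (hL : 2 ≤ L) (ops₀ : ℝ → ZdIdx d L → ℕ → OpsZd d 𝔸) (M : ℝ) (i : ZdIdx d L)
    {a : Site d} {Mc ρ : ℕ} (hρ : L ≤ ρ) (hΩ : i.Ω = cubeFam false L a Mc ρ i.k) (hΛs : i.Λs = cubeLamS L a Mc ρ i.k) {m : ℕ} (hm : m ≤ i.k) :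
    ∃ α : ℝ, 0 < α ∧ ∀ U₀ : Site d → Fin d → 𝔸ˣ, (∀ x κ, U₀ x κ ∈ unitaryUnits 𝔸) →
      pdevOn (fun i' => sqLo L a ρ i.k 0 i' - 3) (fun i' => sqHi L a Mc ρ i.k 0 i' + 3) U₀ < α →
        ∀ A ∈ domSubH (𝔸 := 𝔸) (i.Ω 0), ∀ J : Site d → Fin d → 𝔸,
          (∀ (y : Site d) (μ : Fin d), BondTouches (i.Ω 0) y μ → J y μ = deltaAOf i.η (opsAllZd τ L (cubeLamBP L a Mc ρ i.k) ops₀ M i m) U₀ A y μ) →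
          gopZdH i.η (opsAllZd τ L (cubeLamBP L a Mc ρ i.k) ops₀ M i m) (i.Ω 0) U₀ J = A := by
  obtain ⟨α, hα, h⟩ := regularAtH_of_pdevOn_lt_cube τ hτp hτt hτs hd2 hL ops₀ M i hρ hΩ hΛs hm
  exact ⟨α, hα, fun U₀ hU₀ hsmall A hA J hJ => gopZdH_apply_eq_of_regularAtH i.η _ (i.Ω 0) U₀ (h U₀ hU₀ hsmall).1 hA hJ⟩

include hτp hτt hτs in
/-- ★★ **THE DIRICHLET PROBLEM `□₀Δ_a(U₀)A = J` IS UNIQUELY SOLVABLE ON `E_𝔤(□₀)` AT EVERY SMALL FIELD NEAR THE MEMBER** (`α` as above).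
[cite: Balaban1985BackgroundPropagators, (3.27) p.395 («G = (Δ_a↾Ω₀)⁻¹»), Thm 3.11 p.416] -/
theorem existsUnique_dirichlet_of_pdevOn_lt_cube (hd2 : 2 ≤ d) (hL : 2 ≤ L) (ops₀ : ℝ → ZdIdx d L → ℕ → OpsZd d 𝔸) (M : ℝ) (i : ZdIdx d L)
    {a : Site d} {Mc ρ : ℕ} (hρ : L ≤ ρ) (hΩ : i.Ω = cubeFam false L a Mc ρ i.k) (hΛs : i.Λs = cubeLamS L a Mc ρ i.k) {m : ℕ} (hm : m ≤ i.k) :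
    ∃ α : ℝ, 0 < α ∧ ∀ U₀ : Site d → Fin d → 𝔸ˣ, (∀ x κ, U₀ x κ ∈ unitaryUnits 𝔸) →
      pdevOn (fun i' => sqLo L a ρ i.k 0 i' - 3) (fun i' => sqHi L a Mc ρ i.k 0 i' + 3) U₀ < α →
        ∀ J ∈ domSubH (𝔸 := 𝔸) (i.Ω 0), ∃! A : domSubH (𝔸 := 𝔸) (i.Ω 0),
          B9Eq327GreenZd.deltaADom i.η (opsAllZd τ L (cubeLamBP L a Mc ρ i.k) ops₀ M i m) (i.Ω 0) U₀ A = J := by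
  obtain ⟨α, hα, h⟩ := regularAtH_of_pdevOn_lt_cube τ hτp hτt hτs hd2 hL ops₀ M i hρ hΩ hΛs hm
  refine ⟨α, hα, fun U₀ hU₀ hsmall J hJ => ?_⟩
  obtain ⟨Φ, hΦ, hbij⟩ := (h U₀ hU₀ hsmall).1
  obtain ⟨A, hA⟩ := hbij.2 ⟨J, hJ⟩
  refine ⟨A, ?_, fun B hB => ?_⟩
  · show B9Eq327GreenZd.deltaADom i.η _ (i.Ω 0) U₀ A = J
    rw [← hΦ A, hA]
  · apply hbij.1
    apply Subtype.ext
    rw [hΦ B, hB, hA]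

end Unconditional

end Literature.MathematicalPhysics.QuantumFieldTheory.Balaban1983to89.B9Thm311PerMemberCubeZdUnconditional

end
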